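import Summits.CriticalPhenomena.PercolationContinuityZ3.Theorems.PercNearOneGluingNoHeavyLowerTailKnQuestion8CoefficientwiseRootEdgeDomination
import Summits.CriticalPhenomena.PercolationContinuityZ3.Theorems.PercNearOneGluingNoHeavyLowerTailKnQuestion8CoefficientwiseLeakNoCoreFree
import Summits.CriticalPhenomena.PercolationContinuityZ3.Theorems.PercNearOneGluingNoHeavyLowerTailKnQuestion8CoefficientwiseRootSectorTwo
import HarnessLib

/-!
# Root-edge domination (REM) is a THEOREM when the root lies on no cycle avoiding the root edge — in particular at every root of degree two — prim-lf-2 gen 66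

Support file (`--supports stmt-CriticalPhenomena-4575`, closed), prover `prim-lf-2` (gen 66).  No definitions, no named facts, no sorries; standard axioms.
Memo `prim-lf-2/CW-BASE-gen66.md` §7.4–7.8.  Assembles gen 66's `rem_nonneg_of_leak` ((L) ⟹ (REM), `…CoefficientwiseRootEdgeDomination.lean`) with the THEOREM (L′)
(`leak_blue_dominates_red_sub`, `…CoefficientwiseLeakNoCoreFree.lean`).

Setting: finite multigraph `ends : ι → Sym2 V`, edge set `E`, root `x`, target set `W ∌ x`, `C_v(s) = openCluster (ends '' s) v`; for a root edge `e` (ends `{x,p}`, `p ≠ x`)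
`REM_E(e; x, W)[g] := Σ_{s ⊆ E : e ∈ s, ∀ w∈W ¬(w ∈ C_x s ∧ w ∈ C_x(E∖s))} (g(C_x s) − g(C_x(E∖s)))` (CONJECTURE (REM), gen 66: `≥ 0` for monotone `g`; exact census 0 / 6.2 M).
The leak lemma (L) differs from the proved (L′) only by the no-core side condition `∀ w ∈ W, ¬(w ∈ C_x t ∧ w ∈ C_x(E'∖t))` on `G − e` (`E' = E.erase e`), which is AUTOMATIC when no vertex
other than `x` can be joined to `x` by a red and by a blue path of `G − e` simultaneously — i.e. when `x` lies on no cycle of `G − e`.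
* `Coefficientwise.rem_nonneg_of_rootOffCycles` — **THEOREM**: if every `v` with `v ∈ C_x(t)` and `v ∈ C_x(E'∖t)` for some `t ⊆ E'` equals `x`, then `0 ≤ REM_E(e; x, W)[g]` for every `W ∌ x`
  and monotone `g`.
* `Coefficientwise.rem_nonneg_of_rootDegTwo` — **COROLLARY (degree-two roots)**: if the only edges of `E` at `x` are `e ≠ e'`, then `0 ≤ REM_E(e; x, W)[g]`.  With `p ∈ W` this is the NC*
  POINT ROW at the target-neighbour `p` of a degree-two root, `Σ_{Ev_W} (1_p(K) − 1_p(B))(g K − g B) ≥ 0`, for every target SET `W ∋ p` (memo §7.4).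
[cite: KozmaNitzan2024, Questions 8–9 (§5.5 p. 36) (context: the Question-8 pocket covariance programme)]
-/

namespace Summit.CriticalPhenomena.PercolationContinuityZ3.Theorems

open Finset Literature.Probability.Percolation

namespace Coefficientwise

variable {ι V : Type*} [DecidableEq ι] (ends : ι → Sym2 V)

open Classical in
/-- **(REM) when the root lies on no cycle of `G − e`.**  If for every `t ⊆ E.erase e` the red and the blue cluster of `x` in `G − e` meet only in `x`, then for every `W ∌ x` and
monotone `g`: `0 ≤ Σ_{s ⊆ E : e ∈ s, Ev_W(s)} (g(C_x s) − g(C_x(E∖s)))`.  [cite: KozmaNitzan2024, Questions 8–9 (§5.5 p. 36) (context)] -/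
theorem rem_nonneg_of_rootOffCycles (E : Finset ι) {e : ι} (he : e ∈ E) {x p : V} (hxp : ends e = s(x, p)) (hpx : p ≠ x)
    (W : Set V) (hxW : x ∉ W) (g : Set V → ℝ) (hg : Monotone g)
    (hx : ∀ t : Finset ι, t ⊆ E.erase e → ∀ v : V,
      v ∈ openCluster (ends '' (↑t : Set ι)) x → v ∈ openCluster (ends '' (↑((E.erase e) \ t) : Set ι)) x → v = x) :
    0 ≤ ∑ s ∈ E.powerset.filter (fun s : Finset ι => e ∈ s ∧
          ∀ w ∈ W, ¬ (w ∈ openCluster (ends '' (↑s : Set ι)) x ∧ w ∈ openCluster (ends '' (↑(E \ s) : Set ι)) x)),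
      (g (openCluster (ends '' (↑s : Set ι)) x) - g (openCluster (ends '' (↑(E \ s) : Set ι)) x)) := by
  refine rem_nonneg_of_leak ends E he hxp hpx W g hg ?_
  set E' : Finset ι := E.erase e with hE'
  -- on `G − e` the no-core side condition is automatic, so the leak sum of (L) is the leak sum of the theorem (L′)
  have hfilter : (E'.powerset.filter (fun t : Finset ι =>
        p ∉ openCluster (ends '' (↑t : Set ι)) x ∧
        (∀ w ∈ W, ¬ (w ∈ openCluster (ends '' (↑t : Set ι)) x ∧ w ∈ openCluster (ends '' (↑(E' \ t) : Set ι)) x)) ∧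
        (∃ w ∈ W, w ∈ openCluster (ends '' (↑t : Set ι)) p ∧ w ∈ openCluster (ends '' (↑(E' \ t) : Set ι)) x))) =
      (E'.powerset.filter (fun t : Finset ι =>
        p ∉ openCluster (ends '' (↑t : Set ι)) x ∧
        (∃ w ∈ W, w ∈ openCluster (ends '' (↑t : Set ι)) p ∧ w ∈ openCluster (ends '' (↑(E' \ t) : Set ι)) x))) := by
    refine Finset.filter_congr fun t ht => ?_
    have htE : t ⊆ E' := Finset.mem_powerset.mp ht
    constructor
    · rintro ⟨h1, -, h3⟩; exact ⟨h1, h3⟩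
    · rintro ⟨h1, h3⟩
      refine ⟨h1, fun w hw hwc => ?_, h3⟩
      have hwx : w = x := hx t htE w hwc.1 hwc.2
      exact hxW (hwx ▸ hw)
  rw [hfilter]
  exact leak_blue_dominates_red_sub ends E' x p W g hg

open Classical in
/-- **(REM) at a root of degree two** (THEOREM).  If the only edges of `E` at `x` are `e ≠ e'` (`e` with ends `{x,p}`, `p ≠ x`), then for every `W ∌ x` and monotone `g`:
`0 ≤ Σ_{s ⊆ E : e ∈ s, Ev_W(s)} (g(C_x s) − g(C_x(E∖s)))`.  (In `G − e` the root is a leaf, so its red and blue clusters meet only in `x`.)  For `p ∈ W` this is the NC* point row at `p`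
for every target set `W ∋ p`.  [cite: KozmaNitzan2024, Questions 8–9 (§5.5 p. 36) (context)] -/
theorem rem_nonneg_of_rootDegTwo (E : Finset ι) {e e' : ι} (he : e ∈ E) {x p : V} (hxp : ends e = s(x, p)) (hpx : p ≠ x)
    (hroot : ∀ i ∈ E, x ∈ ends i → i = e ∨ i = e')
    (W : Set V) (hxW : x ∉ W) (g : Set V → ℝ) (hg : Monotone g) :
    0 ≤ ∑ s ∈ E.powerset.filter (fun s : Finset ι => e ∈ s ∧
          ∀ w ∈ W, ¬ (w ∈ openCluster (ends '' (↑s : Set ι)) x ∧ w ∈ openCluster (ends '' (↑(E \ s) : Set ι)) x)),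
      (g (openCluster (ends '' (↑s : Set ι)) x) - g (openCluster (ends '' (↑(E \ s) : Set ι)) x)) := by
  refine rem_nonneg_of_rootOffCycles ends E he hxp hpx W hxW g hg ?_
  intro t ht v hv1 hv2
  -- at most the edge `e'` of `E.erase e` contains `x`; it lies in `t` or in its complement, and the other side has no edge at `x`
  have hside : ∀ u : Finset ι, u ⊆ E.erase e → e' ∉ u → ∀ i ∈ u, x ∉ ends i := by
    intro u hu he'u i hi hxi
    have hiE : i ∈ E := Finset.mem_of_mem_erase (hu hi)
    rcases hroot i hiE hxi with h | h
    · exact (Finset.notMem_erase e E) (h ▸ hu hi)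
    · exact he'u (h ▸ hi)
  by_cases he't : e' ∈ t
  · have hnot : e' ∉ (E.erase e) \ t := fun h => (Finset.mem_sdiff.mp h).2 he't
    exact (mem_openCluster_iff_eq_of_rootless ends (hside _ Finset.sdiff_subset hnot)).mp hv2
  · exact (mem_openCluster_iff_eq_of_rootless ends (hside t ht he't)).mp hv1

open Classical in
/-- **(REM) when no TARGET shares a cycle with the root in `G − e`** (prim-lf-2 gen 66; strengthens `rem_nonneg_of_rootOffCycles` by restricting its hypothesis to the target
set): if no `w ∈ W` is joined to `x` by a red and by a blue path of `G − e` simultaneously, for any colouring `t ⊆ E.erase e`, then `0 ≤ REM_E(e; x, W)[g]` for monotone `g`.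
(The leak lemma (L) then coincides with the proved (L′).)  [cite: KozmaNitzan2024, Questions 8–9 (§5.5 p. 36) (context)] -/
theorem rem_nonneg_of_targetsOffRootCycles (E : Finset ι) {e : ι} (he : e ∈ E) {x p : V} (hxp : ends e = s(x, p)) (hpx : p ≠ x)
    (W : Set V) (g : Set V → ℝ) (hg : Monotone g)
    (hW : ∀ t : Finset ι, t ⊆ E.erase e → ∀ w ∈ W,
      ¬ (w ∈ openCluster (ends '' (↑t : Set ι)) x ∧ w ∈ openCluster (ends '' (↑((E.erase e) \ t) : Set ι)) x)) :
    0 ≤ ∑ s ∈ E.powerset.filter (fun s : Finset ι => e ∈ s ∧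
          ∀ w ∈ W, ¬ (w ∈ openCluster (ends '' (↑s : Set ι)) x ∧ w ∈ openCluster (ends '' (↑(E \ s) : Set ι)) x)),
      (g (openCluster (ends '' (↑s : Set ι)) x) - g (openCluster (ends '' (↑(E \ s) : Set ι)) x)) := by
  refine rem_nonneg_of_leak ends E he hxp hpx W g hg ?_
  set E' : Finset ι := E.erase e with hE'
  have hfilter : (E'.powerset.filter (fun t : Finset ι =>
        p ∉ openCluster (ends '' (↑t : Set ι)) x ∧
        (∀ w ∈ W, ¬ (w ∈ openCluster (ends '' (↑t : Set ι)) x ∧ w ∈ openCluster (ends '' (↑(E' \ t) : Set ι)) x)) ∧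
        (∃ w ∈ W, w ∈ openCluster (ends '' (↑t : Set ι)) p ∧ w ∈ openCluster (ends '' (↑(E' \ t) : Set ι)) x))) =
      (E'.powerset.filter (fun t : Finset ι =>
        p ∉ openCluster (ends '' (↑t : Set ι)) x ∧
        (∃ w ∈ W, w ∈ openCluster (ends '' (↑t : Set ι)) p ∧ w ∈ openCluster (ends '' (↑(E' \ t) : Set ι)) x))) := by
    refine Finset.filter_congr fun t ht => ?_
    have htE : t ⊆ E' := Finset.mem_powerset.mp ht
    constructor
    · rintro ⟨h1, -, h3⟩; exact ⟨h1, h3⟩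
    · rintro ⟨h1, h3⟩; exact ⟨h1, hW t htE, h3⟩
  rw [hfilter]
  exact leak_blue_dominates_red_sub ends E' x p W g hg

end Coefficientwise

end Summit.CriticalPhenomena.PercolationContinuityZ3.Theorems
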